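import Mathlib.Geometry.Manifold.MFDeriv.Atlas
import Mathlib.Geometry.Manifold.MFDeriv.FDeriv
import Mathlib.Geometry.Manifold.ContMDiff.Defs
import Literature.Topology.FourManifolds.RegularValuePreimage
import HarnessLib

/-!
# The submersive locus of a `C¹` map between manifolds is open

Topic `Literature/Topology/Immersions`; general differential topology (Hirsch, *Differential
Topology* (1976), Ch. 1 §3, before Thm. 3.2: *"the set of regular points of `f` is open"*; the
rank of the differential is lower semicontinuous).  The sibling file
`SurjectiveDifferentialOpen.lean` proves this for `C^∞` maps `F : V → ℝ^q` into a EUCLIDEAN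
SPACE; here the target is an arbitrary manifold `N` modelled on a finite-dimensional real normed
space (boundaryless self-model `𝓘(ℝ, E')`), e.g. the round sphere `S² ⊆ ℝ³` with its
stereographic atlas (`𝓡 2 = 𝓘(ℝ, EuclideanSpace ℝ (Fin 2))`), which is the target of (broken)
Lefschetz fibrations, and the map is only assumed `C¹`.

* `surjective_mfderiv_iff_fderiv_writtenInCharts` — for `x` in the chart domain of `x₀` with
  `f x` in the chart domain of `f x₀`, `df_x` is onto iff the derivative of `f` written in the
  extended charts at `x₀` and `f x₀`, `D(ψ ∘ f ∘ φ⁻¹)(φ x)`, is onto (the chart differentials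
  are invertible, `isInvertible_mfderiv_extChartAt`);
* `isOpen_setOf_surjective_mfderiv_of_contMDiff` — **`{x | df_x onto}` is open** for a `C¹`
  map `f : M → N`: in the charts the condition reads through the continuous family
  `y ↦ D(ψ ∘ f ∘ φ⁻¹)(y)` (`contMDiffOn_iff`, `ContDiffOn.continuousOn_fderiv_of_isOpen`), and
  surjectivity of a continuous family of linear maps between finite-dimensional spaces is an
  open condition (`Literature.Topology.FourManifolds.isOpen_inter_setOf_surjective`);
* `isClosed_setOf_not_surjective_mfderiv_of_contMDiff` — the complement: **the critical set
  `{x | df_x not onto}` of a `C¹` map is closed** (hence compact on a compact manifold,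
  `isCompact_setOf_not_surjective_mfderiv_of_contMDiff`).

Everything here is proved; no definitions, no named facts.

## References

* M. W. Hirsch, *Differential Topology*, GTM 33 (1976), Ch. 1 §3 (regular points form an open
  set). [HirschDT1976]
-/

open scoped Manifold ContDiff Topology
open Set Function

noncomputable section

namespace Literature.Topology.Immersions

open Literature.Topology.FourManifolds (isOpen_inter_setOf_surjective)

variable {E : Type*} [NormedAddCommGroup E] [NormedSpace ℝ E] [FiniteDimensional ℝ E]
  {E' : Type*} [NormedAddCommGroup E'] [NormedSpace ℝ E'] [FiniteDimensional ℝ E']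
  {M : Type*} [TopologicalSpace M] [ChartedSpace E M] [IsManifold 𝓘(ℝ, E) 1 M]
  {N : Type*} [TopologicalSpace N] [ChartedSpace E' N] [IsManifold 𝓘(ℝ, E') 1 N]
  {n : WithTop ℕ∞} {f : M → N}

omit [FiniteDimensional ℝ E] [FiniteDimensional ℝ E'] in
/-- **Chain rule in a pair of extended charts.**  For a `C¹` map `f : M → N`, a point `x` in
the domain of the extended chart `φ` at `x₀` with `f x` in the domain of the extended chart `ψ`
at `y₀`, the derivative of `f` written in these charts satisfies
`D(ψ ∘ f ∘ φ⁻¹)(φ x) ∘ dφ_x = dψ_{f x} ∘ df_x`. [folklore] -/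
theorem fderiv_writtenInCharts_comp_mfderiv_extChartAt (hf : ContMDiff 𝓘(ℝ, E) 𝓘(ℝ, E') n f)
    (hn : 1 ≤ n) (x₀ : M) (y₀ : N) {x : M} (hx : x ∈ (extChartAt 𝓘(ℝ, E) x₀).source)
    (hfx : f x ∈ (extChartAt 𝓘(ℝ, E') y₀).source) :
    (fderiv ℝ (extChartAt 𝓘(ℝ, E') y₀ ∘ f ∘ (extChartAt 𝓘(ℝ, E) x₀).symm)
        (extChartAt 𝓘(ℝ, E) x₀ x)).comp (mfderiv 𝓘(ℝ, E) 𝓘(ℝ, E) (extChartAt 𝓘(ℝ, E) x₀) x) =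
      (mfderiv 𝓘(ℝ, E') 𝓘(ℝ, E') (extChartAt 𝓘(ℝ, E') y₀) (f x)).comp
        (mfderiv 𝓘(ℝ, E) 𝓘(ℝ, E') f x) := by
  set φ := extChartAt 𝓘(ℝ, E) x₀ with hφ
  set ψ := extChartAt 𝓘(ℝ, E') y₀ with hψ
  set F : E → E' := ψ ∘ f ∘ φ.symm with hF
  have hf1 : ContMDiff 𝓘(ℝ, E) 𝓘(ℝ, E') 1 f := hf.of_le hn
  -- `F` is `C¹` on the open set `T = φ.target ∩ φ⁻¹' (f ⁻¹' ψ.source)`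
  set T : Set E := φ.target ∩ φ.symm ⁻¹' (univ ∩ f ⁻¹' ψ.source) with hT
  have hFT : ContDiffOn ℝ 1 F T := (contMDiffOn_iff.1 hf1.contMDiffOn).2 x₀ y₀
  have hTo : IsOpen T := by
    refine (continuousOn_extChartAt_symm x₀).isOpen_inter_preimage
      (isOpen_extChartAt_target x₀) ?_
    exact (isOpen_univ.inter ((isOpen_extChartAt_source y₀).preimage hf1.continuous))
  have hxT : φ x ∈ T := by
    refine ⟨φ.map_source hx, ?_⟩
    show φ.symm (φ x) ∈ univ ∩ f ⁻¹' ψ.source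
    rw [φ.left_inv hx]
    exact ⟨mem_univ _, hfx⟩
  have hFd : HasMFDerivAt 𝓘(ℝ, E) 𝓘(ℝ, E') F (φ x) (fderiv ℝ F (φ x)) :=
    hasMFDerivAt_iff_hasFDerivAt.2
      ((hFT.differentiableOn one_ne_zero).differentiableAt (hTo.mem_nhds hxT)).hasFDerivAt
  -- chart differentials
  have hφd : HasMFDerivAt 𝓘(ℝ, E) 𝓘(ℝ, E) φ x (mfderiv 𝓘(ℝ, E) 𝓘(ℝ, E) φ x) := by
    have hx' : x ∈ (chartAt E x₀).source := by rwa [← extChartAt_source 𝓘(ℝ, E)]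
    exact (mdifferentiableAt_extChartAt hx').hasMFDerivAt
  have hψd : HasMFDerivAt 𝓘(ℝ, E') 𝓘(ℝ, E') ψ (f x) (mfderiv 𝓘(ℝ, E') 𝓘(ℝ, E') ψ (f x)) := by
    have hfx' : f x ∈ (chartAt E' y₀).source := by rwa [← extChartAt_source 𝓘(ℝ, E')]
    exact (mdifferentiableAt_extChartAt hfx').hasMFDerivAt
  have hfd : HasMFDerivAt 𝓘(ℝ, E) 𝓘(ℝ, E') f x (mfderiv 𝓘(ℝ, E) 𝓘(ℝ, E') f x) :=
    ((hf1 x).mdifferentiableAt one_ne_zero).hasMFDerivAt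
  -- `F ∘ φ = ψ ∘ f` near `x`
  have heq : (fun z => ψ (f z)) =ᶠ[𝓝 x] fun z => F (φ z) := by
    filter_upwards [(isOpen_extChartAt_source x₀).mem_nhds hx] with z hz
    simp only [hF, Function.comp_apply, φ.left_inv hz]
  have h1 : HasMFDerivAt 𝓘(ℝ, E) 𝓘(ℝ, E') (fun z => ψ (f z)) x
      ((mfderiv 𝓘(ℝ, E') 𝓘(ℝ, E') ψ (f x)).comp (mfderiv 𝓘(ℝ, E) 𝓘(ℝ, E') f x)) :=
    hψd.comp x hfd
  have h2 : HasMFDerivAt 𝓘(ℝ, E) 𝓘(ℝ, E') (fun z => F (φ z)) x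
      ((fderiv ℝ F (φ x)).comp (mfderiv 𝓘(ℝ, E) 𝓘(ℝ, E) φ x)) :=
    hFd.comp x hφd
  rw [← h1.mfderiv, ← h2.mfderiv]
  exact heq.mfderiv_eq.symm

omit [FiniteDimensional ℝ E] [FiniteDimensional ℝ E'] in
/-- **Onto differential, read in charts**: for a `C¹` map `f : M → N`, `x` in the domain of the
extended chart `φ` at `x₀` and `f x` in the domain of the extended chart `ψ` at `y₀`, `df_x` is
onto iff `D(ψ ∘ f ∘ φ⁻¹)(φ x)` is onto (the chart differentials `dφ_x`, `dψ_{f x}` are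
invertible). [folklore] -/
theorem surjective_mfderiv_iff_fderiv_writtenInCharts (hf : ContMDiff 𝓘(ℝ, E) 𝓘(ℝ, E') n f)
    (hn : 1 ≤ n) (x₀ : M) (y₀ : N) {x : M} (hx : x ∈ (extChartAt 𝓘(ℝ, E) x₀).source)
    (hfx : f x ∈ (extChartAt 𝓘(ℝ, E') y₀).source) :
    Surjective (mfderiv 𝓘(ℝ, E) 𝓘(ℝ, E') f x) ↔
      Surjective (fderiv ℝ (extChartAt 𝓘(ℝ, E') y₀ ∘ f ∘ (extChartAt 𝓘(ℝ, E) x₀).symm)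
        (extChartAt 𝓘(ℝ, E) x₀ x)) := by
  have hcomp := fderiv_writtenInCharts_comp_mfderiv_extChartAt hf hn x₀ y₀ hx hfx
  have hφi := isInvertible_mfderiv_extChartAt (I := 𝓘(ℝ, E)) hx
  have hψi := isInvertible_mfderiv_extChartAt (I := 𝓘(ℝ, E')) hfx
  have hfun : ∀ w, fderiv ℝ (extChartAt 𝓘(ℝ, E') y₀ ∘ f ∘ (extChartAt 𝓘(ℝ, E) x₀).symm)
      (extChartAt 𝓘(ℝ, E) x₀ x) (mfderiv 𝓘(ℝ, E) 𝓘(ℝ, E) (extChartAt 𝓘(ℝ, E) x₀) x w) =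
        mfderiv 𝓘(ℝ, E') 𝓘(ℝ, E') (extChartAt 𝓘(ℝ, E') y₀) (f x)
          (mfderiv 𝓘(ℝ, E) 𝓘(ℝ, E') f x w) := fun w =>
    DFunLike.congr_fun hcomp w
  constructor
  · intro hs e'
    obtain ⟨w, hw⟩ := (hψi.surjective.comp hs) e'
    exact ⟨mfderiv 𝓘(ℝ, E) 𝓘(ℝ, E) (extChartAt 𝓘(ℝ, E) x₀) x w, by rw [hfun w]; exact hw⟩
  · intro hs z
    obtain ⟨v, hv⟩ := hs (mfderiv 𝓘(ℝ, E') 𝓘(ℝ, E') (extChartAt 𝓘(ℝ, E') y₀) (f x) z)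
    obtain ⟨w, rfl⟩ := hφi.surjective v
    rw [hfun w] at hv
    exact ⟨w, hψi.injective hv⟩

/-- **The submersive locus of a `C¹` map between manifolds is open** (Hirsch 1976, Ch. 1 §3:
*"the set of regular points of `f` is open"*): for a `C¹` map `f : M → N` between manifolds
modelled on finite-dimensional real normed spaces, `{x | df_x onto}` is open.  In the extended
charts `φ` at `x₀` and `ψ` at `f x₀` the condition reads `D(ψ ∘ f ∘ φ⁻¹)(φ x)` onto
(`surjective_mfderiv_iff_fderiv_writtenInCharts`), a continuous family of linear maps on an
open set, for which surjectivity is an open condition. [cite: HirschDT1976, Ch. 1 §3] -/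
theorem isOpen_setOf_surjective_mfderiv_of_contMDiff (hf : ContMDiff 𝓘(ℝ, E) 𝓘(ℝ, E') n f)
    (hn : 1 ≤ n) : IsOpen {x : M | Surjective (mfderiv 𝓘(ℝ, E) 𝓘(ℝ, E') f x)} := by
  rw [isOpen_iff_forall_mem_open]
  intro x₀ hx₀
  set φ := extChartAt 𝓘(ℝ, E) x₀ with hφ
  set ψ := extChartAt 𝓘(ℝ, E') (f x₀) with hψ
  set F : E → E' := ψ ∘ f ∘ φ.symm with hF
  have hf1 : ContMDiff 𝓘(ℝ, E) 𝓘(ℝ, E') 1 f := hf.of_le hn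
  set T : Set E := φ.target ∩ φ.symm ⁻¹' (univ ∩ f ⁻¹' ψ.source) with hT
  have hFT : ContDiffOn ℝ 1 F T := (contMDiffOn_iff.1 hf1.contMDiffOn).2 x₀ (f x₀)
  have hTo : IsOpen T := by
    refine (continuousOn_extChartAt_symm x₀).isOpen_inter_preimage
      (isOpen_extChartAt_target x₀) ?_
    exact (isOpen_univ.inter ((isOpen_extChartAt_source (f x₀)).preimage hf1.continuous))
  -- the open set of good chart points
  have hW : IsOpen {y ∈ T | Surjective (fderiv ℝ F y)} :=
    isOpen_inter_setOf_surjective hTo (hFT.continuousOn_fderiv_of_isOpen hTo le_rfl)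
  -- its preimage under `φ`, inside `φ.source ∩ f ⁻¹' ψ.source`
  set S : Set M := φ.source ∩ f ⁻¹' ψ.source with hS
  have hSo : IsOpen S :=
    (isOpen_extChartAt_source x₀).inter ((isOpen_extChartAt_source (f x₀)).preimage hf1.continuous)
  have hO : IsOpen (φ.source ∩ φ ⁻¹' {y ∈ T | Surjective (fderiv ℝ F y)}) :=
    (continuousOn_extChartAt x₀).isOpen_inter_preimage (isOpen_extChartAt_source x₀) hW
  refine ⟨S ∩ (φ.source ∩ φ ⁻¹' {y ∈ T | Surjective (fderiv ℝ F y)}), ?_, hSo.inter hO, ?_⟩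
  · rintro x ⟨⟨hx, hfx⟩, -, -, hsx⟩
    exact (surjective_mfderiv_iff_fderiv_writtenInCharts hf hn x₀ (f x₀) hx hfx).2 hsx
  · have hx₀φ : x₀ ∈ φ.source := mem_extChartAt_source x₀
    have hx₀ψ : f x₀ ∈ ψ.source := mem_extChartAt_source (f x₀)
    have hx₀T : φ x₀ ∈ T := by
      refine ⟨φ.map_source hx₀φ, ?_⟩
      show φ.symm (φ x₀) ∈ univ ∩ f ⁻¹' ψ.source
      rw [φ.left_inv hx₀φ]
      exact ⟨mem_univ _, hx₀ψ⟩
    exact ⟨⟨hx₀φ, hx₀ψ⟩, hx₀φ, hx₀T,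
      (surjective_mfderiv_iff_fderiv_writtenInCharts hf hn x₀ (f x₀) hx₀φ hx₀ψ).1 hx₀⟩

/-- **The critical set of a `C¹` map between manifolds is closed**: `{x | df_x not onto}` is
the complement of the open submersive locus. [cite: HirschDT1976, Ch. 1 §3] -/
theorem isClosed_setOf_not_surjective_mfderiv_of_contMDiff
    (hf : ContMDiff 𝓘(ℝ, E) 𝓘(ℝ, E') n f) (hn : 1 ≤ n) :
    IsClosed {x : M | ¬ Surjective (mfderiv 𝓘(ℝ, E) 𝓘(ℝ, E') f x)} := by
  rw [← isOpen_compl_iff]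
  convert isOpen_setOf_surjective_mfderiv_of_contMDiff hf hn using 1
  ext x
  simp

/-- On a compact manifold the critical set `{x | df_x not onto}` of a `C¹` map is compact.
[folklore] -/
theorem isCompact_setOf_not_surjective_mfderiv_of_contMDiff [CompactSpace M]
    (hf : ContMDiff 𝓘(ℝ, E) 𝓘(ℝ, E') n f) (hn : 1 ≤ n) :
    IsCompact {x : M | ¬ Surjective (mfderiv 𝓘(ℝ, E) 𝓘(ℝ, E') f x)} :=
  (isClosed_setOf_not_surjective_mfderiv_of_contMDiff hf hn).isCompact

end Literature.Topology.Immersions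

end
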